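import Summits.Ventures.Crystal3D.Theorems.StickyWulffConstantCoaxialWallLawPayerTransCellPlaneTop
import Summits.Ventures.Crystal3D.Theorems.StickyWulffConstantCoaxialWallLawPayerPairCount
import HarnessLib

/-!
# End accounting, census-free, multi-source VII‴: the TWO-PLATE plane-coset translation cell

HONEST FRAMING. Part of the venture `Summits/Ventures/Crystal3D` (cell `crystal3d-full`), helper for the crux
`CoaxialWallLaw` (stmt-Ventures-19481) of `route-Ventures-StickyWulffConstant`, REGISTERED line `WallLedgerF`
(planner cf-p1), open stub `stub_coaxialTwoSlabAdhesion` (general fillings).  Rung credit only; F-C1 not moved.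
Memo HOME/wall-19481-p2/F-NEXT-SPEC.md §S1-STATUS (19481-p2 g4), planner (xxv) two-plate charging.  For a translation
pair `G₀·Λ₀ + s₁`, `G₀·Λ₀ + s₂` and a family `RT` of rising root slots with τ-SKEW orthogonal partners `sk r`, the pooled
end pairs of the bottom plate (`wordNet_trans_endPairs_plane_multi`) and of the top plate pulled back
(`wordNet_trans_endPairs_plane_top`) are DISJOINT: a common pair read by the SAME root from below and from above carries
`⟪G₀⁻¹(b − s₁), sk r⟫ ∈ ½ℤ` and `⟪G₀⁻¹(b − s₂), sk r⟫ ∈ ½ℤ`, whence `2⟪G₀⁻¹(s₂ − s₁), sk r⟫ ∈ ℤ` against skewness;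
a common pair read by DIFFERENT roots `r₁` (below) and `−r₂` (above, `r₂ ≠ r₁`) is excluded by LEMMA X
(`word_target_ne_of_roots_ne`, `…EndUniqueMulti`: two root families `r₁ ≠ ±(−r₂)` never share a target at one ball —
the top witnesses live in the bottom word system by `…PlaneTop`).  One capacity for the union
(`card_endPairs_le_payers_closed`):

`2 · (√2 · (Σ_{r ∈ RT} (G₀ r)₂) · π ρ²) − 24·(12√2π + 36R₀ + 55440) ρ ≤ 78 · #{z ∈ X : deg z ≤ 11, −R₀−2 ≤ z₂ ≤ h+R₀+2}`

(`wordNet_trans_payers_ge_plane_twoPlate`).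

WHAT THIS IS NOT: not the assembly into the stub's inequality (next file: classes (B) and (C) of the translation
trichotomy at `(√6/78)·sin θ'`); F-C1 not moved.
-/

noncomputable section

namespace Summit.Ventures.Crystal3D.Theorems

open Summit.Ventures.Crystal3D Finset
open Literature.MathematicalPhysics.StatisticalMechanics (fccStacking)
open scoped InnerProductSpace

open scoped Classical in
/-- **The two-plate plane-coset translation cell.**  See the module docstring. -/
theorem wordNet_trans_payers_ge_plane_twoPlate
    {δ : ℝ} (hg : KissingGap δ) (hc : KissingClassification δ)
    (G₀ : EuclideanSpace ℝ (Fin 3) ≃ₗᵢ[ℝ] EuclideanSpace ℝ (Fin 3))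
    {F : List (EuclideanSpace ℝ (Fin 3)) → (EuclideanSpace ℝ (Fin 3) ≃ₗᵢ[ℝ] EuclideanSpace ℝ (Fin 3))}
    (hF0 : F [] = G₀) (hFc : ∀ μ κ, F (μ :: κ) = ((ℝ ∙ μ)ᗮ.reflection).trans (F κ))
    (RT : Finset (EuclideanSpace ℝ (Fin 3))) (hRT : ∀ r ∈ RT, r ∈ fccSlots ∧ 0 < (G₀ r) 2)
    (sk : EuclideanSpace ℝ (Fin 3) → EuclideanSpace ℝ (Fin 3))
    (s₁ s₂ : EuclideanSpace ℝ (Fin 3))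
    (hsk : ∀ r ∈ RT, sk r ∈ fccSlots ∧ ⟪r, sk r⟫_ℝ = 0 ∧ ∀ z : ℤ, ⟪G₀.symm (s₂ - s₁), sk r⟫_ℝ ≠ (z : ℝ) / 2)
    (X P₁ P₂ : Finset (EuclideanSpace ℝ (Fin 3))) (R₀ h ρ : ℝ)
    (hR₀ : 10 ≤ R₀) (hh : 0 ≤ h) (hρ : R₀ ≤ ρ)
    (hX : ∀ p ∈ X, ∀ q ∈ X, p ≠ q → 1 ≤ dist p q)
    (hcell : ∀ p ∈ X, -(2 * R₀) ≤ p 2 ∧ p 2 ≤ h + 2 * R₀ ∧ p 0 ^ 2 + p 1 ^ 2 ≤ ρ ^ 2)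
    (hP₁X : P₁ ⊆ X) (hP₂X : P₂ ⊆ X)
    (hP₁ : ∀ p, p ∈ P₁ ↔ (p ∈ (fun q => G₀ q + s₁) '' fccStacking 1 (Real.sqrt (2 / 3)) ∧
      -(2 * R₀) ≤ p 2 ∧ p 2 ≤ -R₀ ∧ p 0 ^ 2 + p 1 ^ 2 ≤ ρ ^ 2))
    (hP₂ : ∀ p, p ∈ P₂ ↔ (p ∈ (fun q => G₀ q + s₂) '' fccStacking 1 (Real.sqrt (2 / 3)) ∧
      h + R₀ ≤ p 2 ∧ p 2 ≤ h + 2 * R₀ ∧ p 0 ^ 2 + p 1 ^ 2 ≤ ρ ^ 2)) :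
    2 * (Real.sqrt 2 * (∑ r ∈ RT, (G₀ r) 2) * Real.pi * ρ ^ 2) -
        24 * (12 * Real.sqrt 2 * Real.pi + 36 * R₀ + 55440) * ρ ≤
      78 * ((X.filter fun z => (X.filter fun q => dist z q = 1).card ≤ 11 ∧
          -R₀ - 2 ≤ z 2 ∧ z 2 ≤ h + R₀ + 2).card : ℝ) := by
  obtain ⟨T₁, hflux₁, hTpair₁, hTpay₁, hTwit₁⟩ :=
    wordNet_trans_endPairs_plane_multi hg hc G₀ hF0 hFc RT hRT sk s₁ s₂ hsk X P₁ P₂ R₀ h ρ hR₀ hh hρ hX hcell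
      hP₁X hP₂X hP₁ hP₂
  obtain ⟨T₂, hflux₂, hTpair₂, hTpay₂, hTwit₂⟩ :=
    wordNet_trans_endPairs_plane_top hg hc G₀ hF0 hFc RT hRT sk s₁ s₂ hsk X P₁ P₂ R₀ h ρ hR₀ hh hρ hX hcell
      hP₁X hP₂X hP₁ hP₂
  -- (1) the two pair sets are disjoint
  have hdisj : Disjoint T₁ T₂ := by
    rw [Finset.disjoint_left]
    intro bq h₁ h₂
    obtain ⟨r₁, hr₁, ⟨z₁, hz₁⟩, κ₁, d₁, hlet₁, hch₁, hd₁, hpat₁⟩ := hTwit₁ bq h₁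
    obtain ⟨r₂, hr₂, ⟨z₂, hz₂⟩, κ₂, d₂, hlet₂, hch₂, hd₂, hpat₂⟩ := hTwit₂ bq h₂
    by_cases hrr : r₁ = r₂
    · -- same root below and above: the half-integer invariants of the end ball clash with the skew partner
      subst hrr
      have e : G₀.symm (s₂ - s₁) = G₀.symm (bq.1 - s₁) - G₀.symm (bq.1 - s₂) := by
        rw [← map_sub]; congr 1; abel
      refine (hsk r₁ hr₁).2.2 (z₁ - z₂) ?_
      rw [e, inner_sub_left, hz₁, hz₂]; push_cast; ring
    · -- different roots: LEMMA X in the bottom word system (roots `r₁` and `−r₂`)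
      have hr₁S := (hRT r₁ hr₁).1
      have hr₂S := neg_mem_fccSlots (hRT r₂ hr₂).1
      have hne : r₁ ≠ -r₂ := by
        intro h'
        have h1 := (hRT r₁ hr₁).2
        have h2 := (hRT r₂ hr₂).2
        rw [h', map_neg, PiLp.neg_apply] at h1
        linarith
      have hne' : r₁ ≠ -(-r₂) := by rw [neg_neg]; exact hrr
      exact word_target_ne_of_roots_ne hX hFc hlet₁ hlet₂ hch₁ hch₂ hr₁S hr₂S hne hne' hd₁ hd₂ hpat₁ hpat₂ rfl
  -- (2) one capacity for the union
  have hU := card_endPairs_le_payers_closed hX (T₁.disjUnion T₂ hdisj) (R₀ := R₀) (h := h)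
    (fun bq hbq => by
      rcases mem_disjUnion.1 hbq with h' | h'
      · obtain ⟨a, b, c, d, e⟩ := hTpair₁ bq h'
        exact ⟨a, b, c, d, e.le⟩
      · exact hTpair₂ bq h')
    (fun bq hbq => by
      rcases mem_disjUnion.1 hbq with h' | h'
      · exact hTpay₁ bq h'
      · exact hTpay₂ bq h')
  rw [card_disjUnion] at hU
  have hPAYeq : (X.filter fun z => (X.filter fun q => dist z q = 1).card ≤ 11 ∧
      -R₀ - 1 - 1 ≤ z 2 ∧ z 2 ≤ h + R₀ + 1 + 1) =
      (X.filter fun z => (X.filter fun q => dist z q = 1).card ≤ 11 ∧ -R₀ - 2 ≤ z 2 ∧ z 2 ≤ h + R₀ + 2) := by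
    refine filter_congr fun z _ => ?_
    rw [show -R₀ - 1 - 1 = -R₀ - 2 by ring, show h + R₀ + 1 + 1 = h + R₀ + 2 by ring]
  rw [hPAYeq] at hU
  have hcast : ((T₁.card : ℕ) : ℝ) + (T₂.card : ℝ) ≤
      78 * ((X.filter fun z => (X.filter fun q => dist z q = 1).card ≤ 11 ∧
          -R₀ - 2 ≤ z 2 ∧ z 2 ≤ h + R₀ + 2).card : ℝ) := by
    exact_mod_cast hU
  linarith only [hflux₁, hflux₂, hcast]

end Summit.Ventures.Crystal3D.Theorems

end
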